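import Literature.NumberTheory.Transcendental.NesterenkoElimination
import HarnessLib

/-!
# Chardin–Philippon: regularity (interpolation) of the isolated zero-dimensional components of a projective scheme cut out by forms

Topic `Literature/RingTheory/GradedAlgebra` (Castelnuovo–Mumford regularity, 13D40; complete
intersections, 14M10). M. Chardin and P. Philippon, *Régularité et interpolation*, J. Algebraic
Geom. 8 (1999) 471–481, with the erratum ibid. 11 (2002) 599–600, prove that the isolated
ZERO-DIMENSIONAL components of the subscheme of `ℙᵐ` cut out by forms `g₁, …, g_k` of degrees
`e₁ ≥ e₂ ≥ ⋯ ≥ e_k ≥ 1` are as regular as a complete intersection of the `m` forms of largest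
degree: the saturated ideal of their union `Z₀` has Castelnuovo–Mumford regularity
`≤ e₁ + ⋯ + e_m − m + 1` ("interpolation": the points of `Z₀` impose independent conditions on
the forms of every degree `ν ≥ e₁ + ⋯ + e_m − m`). For a complete intersection of `m` forms in
`ℙᵐ` this is Macaulay's value `∑ (eᵢ − 1)`; the point of the theorem is that excess (positive-
dimensional) components elsewhere do not spoil it for the isolated points.

This file records the result as a NAMED FACT, in the special form consumed by the transcendence
tree (crux `Summit.Schanuel.Schanuel.Theses.DiophantineDichotomy.ApproximationProperty`, stub
`stub_isolatedPointClause3` of line `orbit-interpolation-determinant`, whose intermediate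
statement `IsolatedPointClause3` is the case `m = k = 3` below): the base field is `ℚ`, the
ambient ring is Nesterenko's `Rx m = ℚ[x₀, …, x_m]` with Mathlib's grading
(`MvPolynomial.homogeneousSubmodule`, local instance `MvPolynomial.gradedAlgebra`), an isolated
zero-dimensional component DEFINED OVER `ℚ` is a homogeneous prime `𝔮` which is a minimal prime of
`(g₁, …, g_k)` and has `dim ℚ[x̲]/𝔮 = 1` (`IsUnmixedOfRank 𝔮 1`: its zeros are one Galois orbit
of isolated points of the scheme over `ℚ̄` — isolatedness is Galois-invariant), its number of
points is Nesterenko's degree `ideg 𝔮 1` (LNM 1752 Ch. 3 Def. 4.5), and "the zeros of `𝔮` impose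
independent conditions on the forms of degree `ν`" is written, as everywhere in that tree, as
`dim ℚ[x̲]_ν = dim (ℚ[x̲]_ν ∩ 𝔮) + deg 𝔮`. Two weakenings keep the statement on the safe side of
the printed one and free of sorting: the threshold is the sum of ALL the degrees (`≥` the sum of
the `m` largest; for `k < m` there is no minimal prime of dimension `1` and the statement is
vacuous), plus one; and only REDUCED isolated components over `ℚ` (primes) are addressed, for
which the printed regularity of the whole isolated part `Z₀` descends (a zero-dimensional
subscheme of a `ν`-regular zero-dimensional scheme is `ν`-regular).
-- TODO(general form): the printed theorem bounds the Castelnuovo–Mumford regularity of the full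
-- (possibly non-reduced) isolated zero-dimensional part `Z₀` over any field by
-- `e₁ + ⋯ + e_m − m + 1` with the `m` LARGEST degrees; stating it needs graded local cohomology /
-- `Proj`, which the tree does not yet use for `ℚ[x̲]`.

Nothing is proved here (`def … : Prop`); discharging it (`chardinPhilippon_isolatedInterpolation_holds`)
is a literature-prover task of size XL (local cohomology with supports / liaison; read the 2002
erratum first). Texts requested: acq-06248 (paper), acq-06484 (erratum).

## References

* [ChardinPhilippon1999] M. Chardin, P. Philippon, *Régularité et interpolation*, J. Algebraic
  Geom. 8 (1999), no. 3, 471–481; erratum ibid. 11 (2002) 599–600 (zbl:0962.13014).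
* [NesterenkoPhilippon2001] Yu. V. Nesterenko, P. Philippon (eds.), *Introduction to Algebraic
  Independence Theory*, LNM 1752 (2001), Ch. 3 §4 (degree of a homogeneous unmixed ideal).
* P. Philippon, *Approximations fonctionnelles des courbes des espaces projectifs*, Int. J. Number
  Theory 7 (2011), §1 and Lemme 3 (use of [ChardinPhilippon1999] in Diophantine approximation).
-/

noncomputable section

open MvPolynomial

attribute [local instance] MvPolynomial.gradedAlgebra

namespace Literature.RingTheory.GradedAlgebra

open Literature.NumberTheory.Transcendental.Nesterenko

/-- **Chardin–Philippon (1999), regularity of isolated points — interpolation form over `ℚ`.**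
Let `g₁, …, g_k ∈ ℚ[x₀, …, x_m]` be forms of degrees `e₁, …, e_k ≥ 1` and let `𝔮` be a
homogeneous prime ideal with `dim ℚ[x̲]/𝔮 = 1` which is a MINIMAL prime of `(g₁, …, g_k)` (the
ideal of a Galois orbit of isolated points of the projective scheme `{g₁ = ⋯ = g_k = 0}`). Then for
every `ν` with `e₁ + ⋯ + e_k + 1 ≤ ν + m` the zeros of `𝔮` impose independent conditions on the
forms of degree `ν`: `dim_ℚ ℚ[x̲]_ν = dim_ℚ (ℚ[x̲]_ν ∩ 𝔮) + deg 𝔮`. (Printed: the Castelnuovo–Mumford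
regularity of the isolated zero-dimensional part is at most the sum of the `m` largest degrees
minus `m` plus one; the threshold here — all degrees, plus one — is on the safe side, and the
reduced `ℚ`-components inherit the regularity of the isolated part.)
[cite: ChardinPhilippon1999, Théorème (régularité des points isolés) + erratum 2002] -/
def chardinPhilippon_isolatedInterpolation : Prop :=
  ∀ (m k : ℕ) (g : Fin k → Rx m) (e : Fin k → ℕ),
    (∀ j, (g j).IsHomogeneous (e j) ∧ 1 ≤ e j) →
    ∀ 𝔮 : Ideal (Rx m), 𝔮.IsPrime → 𝔮.IsHomogeneous (homogeneousSubmodule (Fin (m + 1)) ℚ) →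
      IsUnmixedOfRank 𝔮 1 → 𝔮 ∈ (Ideal.span (Set.range g)).minimalPrimes →
      ∀ ν : ℕ, (∑ j, e j) + 1 ≤ ν + m →
        Module.finrank ℚ ↥(homogeneousSubmodule (Fin (m + 1)) ℚ ν) =
          Module.finrank ℚ ↥(homogeneousSubmodule (Fin (m + 1)) ℚ ν ⊓ 𝔮.restrictScalars ℚ) +
            ideg 𝔮 1

end Literature.RingTheory.GradedAlgebra

end
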